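import Summits.ResolutionOfSingularities.ResolutionOfSingularities.Theorems.EquisingularLiftEquisingularLiftNatNDChartPullback
import Mathlib.FieldTheory.IsAlgClosed.Basic
import Mathlib.Algebra.MvPolynomial.Polynomial
import Summits.ResolutionOfSingularities.ResolutionOfSingularities.Theorems.HilbertSamuelEliminationSigmaMaxModificationsCorridor3CPFrameWeightedMinExponents
import HarnessLib

/-!
# [OURS · L1 W4.5(b) · EL♮(3)] DEAL «ND-K5», brick (B4γ) `ndInv_init` — sub-brick (γ5), part 1: INITIAL FORMS ARE MULTIPLICATIVE, and a
# polynomial with two monomials has a TORUS ZERO over `k̄` (`…NatNDInitialFormMul`; WIDTH TABLE D1 row nose-w1, desk succession ruling 2026-08-28T14:56:41Z)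

Cell `res-hironaka`, crux EL♮(3) `EquisingularLiftNatThree` (stmt-ResolutionOfSingularities-20148), chain W4.5b, line `sections`.
res-L1-w45b-nose-w1 g0 (WIDTH seat; owner of (B4γ) `ND.ndInv_init` after res-type-027 g19's final cycle).  OURS; NOT a statement of any manuscript;
nothing of [Hironaka2017] is asserted; AI-written kernel algebra, weaker than expert review.  Def-free, `sorry`-free, standard axioms.
`--kind proof --supports stmt-ResolutionOfSingularities-20148 --as helper`.  Consumed by part 2 `…NatNDLocalNDSquarefree`
(`ND.sq_dvd_false_of_localND`, res-type-027 g19's typed (γ5) signature).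

CONTENTS (namespace `…Cruxes.EquisingularLiftNat.Sections.ND`; `wt`, `initialForm` are the tree's `…Sections` definitions of `…NatResidueHypDefsND`
p625534 — `in_w F` = the sum of the terms of `F` of minimal `w`-weight):
* §1 INITIAL FORMS: `coeff_initialForm` (the coefficient formula), `initialForm_ne_zero`, and ★ `initialForm_mul` — `in_w (F·G) = in_w F · in_w G`
  over a field (lowest-weight parts multiply: every exponent of `F·G` weighs at least `min F + min G`, and at that weight the coefficients of `F·G`
  are those of `in_w F · in_w G ≠ 0`).
* §2 TORUS ZEROS (base-`D` digits are unique: tree `…SigmaMaxModificationsCorridor3.Helpers.sum_mul_pow_injective_of_lt`): `exists_root_ne_zero_of_coeff_ne_zero` (a univariate polynomial with two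
  distinct non-zero coefficients has a NON-ZERO root over `k̄`: strip `X^{mult₀}`, the cofactor is non-constant), ★ `exists_torus_zero` (a
  polynomial with two distinct exponents in its support vanishes at a point of `(k̄×)ᴺ` — Kronecker substitution `tᵢ = r^{Dⁱ}`, `D >` every
  exponent, turns it into a univariate polynomial with the same coefficients at the base-`D` codes).

References (mathematics): A. G. Kouchnirenko, *Polyèdres de Newton et nombres de Milnor*, Invent. Math. 32 (1976) 1–31, §1 (initial forms);
Kronecker substitution: J. von zur Gathen – J. Gerhard, *Modern Computer Algebra*, 3rd ed. (2013), §8.4.  Both folklore-level here.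
-/

set_option linter.dupNamespace false

noncomputable section

open MvPolynomial

namespace Summit.ResolutionOfSingularities.ResolutionOfSingularities.Cruxes.EquisingularLiftNat.Sections.ND

open Summit.ResolutionOfSingularities.ResolutionOfSingularities.Cruxes.EquisingularLiftNat.Sections

variable {k : Type} [Field k] {N : ℕ}

/-! ## §1 Initial forms: coefficients, weight additivity, multiplicativity -/

/-- The weight is additive in the exponent. [OURS] -/
theorem wt_add (w : Fin N → ℤ) (d₁ d₂ : Fin N →₀ ℕ) : wt w (d₁ + d₂) = wt w d₁ + wt w d₂ := by
  simp only [wt, Finsupp.add_apply, Nat.cast_add, mul_add, Finset.sum_add_distrib]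

/-- The weight of the zero exponent is zero. [OURS] -/
theorem wt_zero (w : Fin N → ℤ) : wt w (0 : Fin N →₀ ℕ) = 0 := by
  simp [wt]

/-- The initial form of `0` is `0`. [OURS] -/
theorem initialForm_zero (w : Fin N → ℤ) : initialForm w (0 : MvPolynomial (Fin N) k) = 0 := by
  unfold initialForm; simp

/-- **Coefficients of the initial form**: for `F ≠ 0`, `coeff d (in_w F)` is `coeff d F` if `d` has the minimal weight
`min_{e ∈ supp F} wt w e`, and `0` otherwise. [OURS] -/
theorem coeff_initialForm (w : Fin N → ℤ) {F : MvPolynomial (Fin N) k} (hF : F.support.Nonempty) (d : Fin N →₀ ℕ) :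
    coeff d (initialForm w F) = if wt w d = F.support.inf' hF (wt w) then coeff d F else 0 := by
  classical
  unfold initialForm
  rw [dif_pos hF, coeff_sum]
  simp only [coeff_monomial]
  rw [Finset.sum_ite_eq' (F.support.filter fun e => wt w e = F.support.inf' hF (wt w)) d (fun e => coeff e F)]
  simp only [Finset.mem_filter, mem_support_iff]
  by_cases hd : coeff d F = 0
  · simp [hd]
  · simp [hd]

/-- The minimal weight is a lower bound on the support. [OURS] -/
theorem inf'_le_wt (w : Fin N → ℤ) {F : MvPolynomial (Fin N) k} (hF : F.support.Nonempty) {d : Fin N →₀ ℕ}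
    (hd : d ∈ F.support) : F.support.inf' hF (wt w) ≤ wt w d :=
  Finset.inf'_le _ hd

/-- A coefficient of the initial form is non-zero only at exponents of minimal weight, where it is the coefficient of `F`. [OURS] -/
theorem wt_eq_of_coeff_initialForm_ne_zero (w : Fin N → ℤ) {F : MvPolynomial (Fin N) k} (hF : F.support.Nonempty)
    {d : Fin N →₀ ℕ} (hd : coeff d (initialForm w F) ≠ 0) :
    wt w d = F.support.inf' hF (wt w) ∧ coeff d (initialForm w F) = coeff d F := by
  rw [coeff_initialForm w hF] at hd ⊢
  by_cases h : wt w d = F.support.inf' hF (wt w)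
  · exact ⟨h, by rw [if_pos h]⟩
  · exact absurd (by rw [if_neg h]) hd

/-- The initial form of a non-zero polynomial is non-zero. [OURS] -/
theorem initialForm_ne_zero (w : Fin N → ℤ) {F : MvPolynomial (Fin N) k} (hF : F ≠ 0) : initialForm w F ≠ 0 := by
  have hF' : F.support.Nonempty := support_nonempty.mpr hF
  obtain ⟨d, hd, hdeq⟩ := Finset.exists_mem_eq_inf' hF' (wt w)
  intro h
  have := congrArg (coeff d) h
  rw [coeff_initialForm w hF', if_pos hdeq.symm, coeff_zero] at this
  exact (mem_support_iff.mp hd) this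

/-- Every exponent of a product has weight at least the sum of the minimal weights of the factors. [OURS] -/
theorem add_inf'_le_wt_of_mem_support_mul (w : Fin N → ℤ) {F G : MvPolynomial (Fin N) k} (hF : F.support.Nonempty)
    (hG : G.support.Nonempty) {d : Fin N →₀ ℕ} (hd : d ∈ (F * G).support) :
    F.support.inf' hF (wt w) + G.support.inf' hG (wt w) ≤ wt w d := by
  classical
  rw [mem_support_iff, coeff_mul] at hd
  obtain ⟨x, hx, hne⟩ := Finset.exists_ne_zero_of_sum_ne_zero hd
  rw [Finset.mem_antidiagonal] at hx
  have h1 : coeff x.1 F ≠ 0 := fun h => hne (by rw [h, zero_mul])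
  have h2 : coeff x.2 G ≠ 0 := fun h => hne (by rw [h, mul_zero])
  rw [← hx, wt_add]
  exact add_le_add (inf'_le_wt w hF (mem_support_iff.mpr h1)) (inf'_le_wt w hG (mem_support_iff.mpr h2))

/-- At an exponent of weight exactly `min F + min G`, the coefficient of `F * G` is that of `in_w F * in_w G`. [OURS] -/
theorem coeff_mul_eq_coeff_initialForm_mul (w : Fin N → ℤ) {F G : MvPolynomial (Fin N) k} (hF : F.support.Nonempty)
    (hG : G.support.Nonempty) {d : Fin N →₀ ℕ} (hd : wt w d = F.support.inf' hF (wt w) + G.support.inf' hG (wt w)) :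
    coeff d (F * G) = coeff d (initialForm w F * initialForm w G) := by
  classical
  rw [coeff_mul, coeff_mul]
  refine Finset.sum_congr rfl fun x hx => ?_
  rw [Finset.mem_antidiagonal] at hx
  rw [coeff_initialForm w hF, coeff_initialForm w hG]
  by_cases h1 : coeff x.1 F = 0
  · rw [h1]; simp
  by_cases h2 : coeff x.2 G = 0
  · rw [h2]; simp
  have hw1 := inf'_le_wt w hF (mem_support_iff.mpr h1)
  have hw2 := inf'_le_wt w hG (mem_support_iff.mpr h2)
  have hsum : wt w x.1 + wt w x.2 = wt w d := by rw [← hx, wt_add]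
  have e1 : wt w x.1 = F.support.inf' hF (wt w) := by omega
  have e2 : wt w x.2 = G.support.inf' hG (wt w) := by omega
  rw [if_pos e1, if_pos e2]

/-- `in_w F * in_w G` is supported in weight `min F + min G`. [OURS] -/
theorem wt_eq_of_coeff_initialForm_mul_ne_zero (w : Fin N → ℤ) {F G : MvPolynomial (Fin N) k} (hF : F.support.Nonempty)
    (hG : G.support.Nonempty) {d : Fin N →₀ ℕ} (hd : coeff d (initialForm w F * initialForm w G) ≠ 0) :
    wt w d = F.support.inf' hF (wt w) + G.support.inf' hG (wt w) := by
  classical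
  rw [coeff_mul] at hd
  obtain ⟨x, hx, hne⟩ := Finset.exists_ne_zero_of_sum_ne_zero hd
  rw [Finset.mem_antidiagonal] at hx
  have h1 : coeff x.1 (initialForm w F) ≠ 0 := fun h => hne (by rw [h, zero_mul])
  have h2 : coeff x.2 (initialForm w G) ≠ 0 := fun h => hne (by rw [h, mul_zero])
  rw [← hx, wt_add, (wt_eq_of_coeff_initialForm_ne_zero w hF h1).1, (wt_eq_of_coeff_initialForm_ne_zero w hG h2).1]

/-- **Initial forms are multiplicative** (over a field): `in_w (F * G) = in_w F * in_w G`. [OURS] -/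
theorem initialForm_mul (w : Fin N → ℤ) (F G : MvPolynomial (Fin N) k) :
    initialForm w (F * G) = initialForm w F * initialForm w G := by
  classical
  by_cases hF0 : F = 0
  · rw [hF0, zero_mul, initialForm_zero, zero_mul]
  by_cases hG0 : G = 0
  · rw [hG0, mul_zero, initialForm_zero, mul_zero]
  have hF : F.support.Nonempty := support_nonempty.mpr hF0
  have hG : G.support.Nonempty := support_nonempty.mpr hG0
  have hFG0 : F * G ≠ 0 := mul_ne_zero hF0 hG0
  have hFG : (F * G).support.Nonempty := support_nonempty.mpr hFG0
  -- the product of the initial forms is non-zero, so the minimal weight of `F * G` is `min F + min G`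
  have hH0 : initialForm w F * initialForm w G ≠ 0 := mul_ne_zero (initialForm_ne_zero w hF0) (initialForm_ne_zero w hG0)
  obtain ⟨d₀, hd₀⟩ := support_nonempty.mpr hH0
  have hd₀' := mem_support_iff.mp hd₀
  have hwd₀ := wt_eq_of_coeff_initialForm_mul_ne_zero w hF hG hd₀'
  have hmin : (F * G).support.inf' hFG (wt w) = F.support.inf' hF (wt w) + G.support.inf' hG (wt w) := by
    apply le_antisymm
    · have : d₀ ∈ (F * G).support := by
        rw [mem_support_iff, coeff_mul_eq_coeff_initialForm_mul w hF hG hwd₀]; exact hd₀'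
      exact (inf'_le_wt w hFG this).trans hwd₀.le
    · obtain ⟨e, he, heq⟩ := Finset.exists_mem_eq_inf' hFG (wt w)
      rw [heq]; exact add_inf'_le_wt_of_mem_support_mul w hF hG he
  ext d
  rw [coeff_initialForm w hFG, hmin]
  by_cases h : wt w d = F.support.inf' hF (wt w) + G.support.inf' hG (wt w)
  · rw [if_pos h, coeff_mul_eq_coeff_initialForm_mul w hF hG h]
  · rw [if_neg h]
    by_contra hne
    exact h (wt_eq_of_coeff_initialForm_mul_ne_zero w hF hG (Ne.symm hne))


/-! ## §2 A polynomial with two distinct monomials has a zero in the torus (Kronecker substitution) -/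

/-- A univariate polynomial over an algebraically closed field with two distinct non-zero coefficients has a NON-ZERO root. [OURS] -/
theorem exists_root_ne_zero_of_coeff_ne_zero [IsAlgClosed k] {q : Polynomial k} {m₁ m₂ : ℕ} (hm : m₁ ≠ m₂)
    (h₁ : q.coeff m₁ ≠ 0) (h₂ : q.coeff m₂ ≠ 0) : ∃ r : k, r ≠ 0 ∧ q.eval r = 0 := by
  have hq : q ≠ 0 := fun h => h₁ (by rw [h, Polynomial.coeff_zero])
  obtain ⟨q', hqq', hndvd⟩ := Polynomial.exists_eq_pow_rootMultiplicity_mul_and_not_dvd q hq 0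
  rw [map_zero, sub_zero] at hqq' hndvd
  set m := q.rootMultiplicity 0 with hm0
  have hq'0 : q'.coeff 0 ≠ 0 := fun h => hndvd (Polynomial.X_dvd_iff.mpr h)
  have hq'ne : q' ≠ 0 := fun h => hq'0 (by rw [h, Polynomial.coeff_zero])
  -- `q'` is not constant: otherwise `q = c X^m` has one non-zero coefficient
  have hdeg : q'.natDegree ≠ 0 := by
    intro hd
    rw [Polynomial.eq_C_of_natDegree_eq_zero hd, mul_comm] at hqq'
    have hc : ∀ j, q.coeff j ≠ 0 → j = m := by
      intro j hj
      rw [hqq', Polynomial.coeff_C_mul_X_pow] at hj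
      by_contra hne
      exact hj (if_neg hne)
    exact hm ((hc m₁ h₁).trans (hc m₂ h₂).symm)
  have hdeg' : q'.degree ≠ 0 := by
    rw [Polynomial.degree_eq_natDegree hq'ne]
    exact_mod_cast hdeg
  obtain ⟨r, hr⟩ := IsAlgClosed.exists_root q' hdeg'
  refine ⟨r, ?_, ?_⟩
  · rintro rfl
    exact hq'0 (by rwa [Polynomial.coeff_zero_eq_eval_zero])
  · rw [hqq', Polynomial.eval_mul, Polynomial.eval_pow, Polynomial.eval_X, hr.eq_zero, mul_zero]

/-- Every coordinate of a support exponent is below `totalDegree + 1`. [OURS] -/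
theorem apply_lt_totalDegree_succ {h : MvPolynomial (Fin N) k} {d : Fin N →₀ ℕ} (hd : d ∈ h.support) (i : Fin N) :
    d i < h.totalDegree + 1 := by
  have h1 : (d.sum fun _ e => e) ≤ h.totalDegree := le_totalDegree hd
  have h2 : d i ≤ d.sum fun _ e => e := by
    classical
    by_cases hi : i ∈ d.support
    · exact Finset.single_le_sum (f := fun j => d j) (fun j _ => Nat.zero_le _) hi
    · rw [Finsupp.notMem_support_iff.mp hi]; exact Nat.zero_le _
  omega

/-- **Torus zero.**  Over an algebraically closed field, a polynomial with (at least) two distinct exponents in its support vanishes at a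
point of the torus `(k×)ᴺ`: substitute the monomial curve `tᵢ = r^{Dⁱ}` (`D` larger than every exponent — Kronecker), whose pull-back is a
univariate polynomial with the same coefficients at the base-`D` codes of the exponents, hence with a non-zero root `r`. [OURS] -/
theorem exists_torus_zero [IsAlgClosed k] {h : MvPolynomial (Fin N) k} {a b : Fin N →₀ ℕ}
    (ha : a ∈ h.support) (hb : b ∈ h.support) (hab : a ≠ b) :
    ∃ x : Fin N → k, (∀ i, x i ≠ 0) ∧ eval x h = 0 := by
  classical
  set D : ℕ := h.totalDegree + 1 with hD
  -- the Kronecker code of an exponent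
  let K : (Fin N →₀ ℕ) → ℕ := fun d => ∑ i, d i * D ^ (i : ℕ)
  have hKinj : ∀ d ∈ h.support, ∀ e ∈ h.support, K d = K e → d = e := by
    intro d hd e he hde
    exact Finsupp.ext (congrFun
      (Summit.ResolutionOfSingularities.ResolutionOfSingularities.Theorems.SigmaMaxModificationsCorridor3.Helpers.sum_mul_pow_injective_of_lt
        (apply_lt_totalDegree_succ hd) (apply_lt_totalDegree_succ he) hde))
  -- the pulled-back univariate polynomial
  set q : Polynomial k := eval₂ Polynomial.C (fun i : Fin N => (Polynomial.X : Polynomial k) ^ D ^ (i : ℕ)) h with hq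
  have hq_eq : q = ∑ d ∈ h.support, Polynomial.monomial (K d) (coeff d h) := by
    rw [hq, eval₂_eq]
    refine Finset.sum_congr rfl fun d _ => ?_
    rw [← Polynomial.C_mul_X_pow_eq_monomial]
    congr 1
    rw [Finset.prod_congr rfl fun (i : Fin N) _ => (pow_mul Polynomial.X (D ^ (i : ℕ)) (d i)).symm, Finset.prod_pow_eq_pow_sum]
    congr 1
    show ∑ i ∈ d.support, D ^ (i : ℕ) * d i = ∑ i, d i * D ^ (i : ℕ)
    rw [Finset.sum_subset (Finset.subset_univ d.support)
      (fun i _ hi => by rw [Finsupp.notMem_support_iff.mp hi, mul_zero])]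
    exact Finset.sum_congr rfl fun i _ => mul_comm _ _
  have hcoeff : ∀ d ∈ h.support, q.coeff (K d) = coeff d h := by
    intro d hd
    rw [hq_eq, Polynomial.finsetSum_coeff]
    simp only [Polynomial.coeff_monomial]
    rw [Finset.sum_eq_single d]
    · rw [if_pos rfl]
    · intro e he hne
      rw [if_neg]
      exact fun hKe => hne (hKinj e he d hd hKe)
    · intro hd'; exact absurd hd hd'
  have hKab : K a ≠ K b := fun hK => hab (hKinj a ha b hb hK)
  obtain ⟨r, hr0, hr⟩ := exists_root_ne_zero_of_coeff_ne_zero hKab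
    (by rw [hcoeff a ha]; exact mem_support_iff.mp ha) (by rw [hcoeff b hb]; exact mem_support_iff.mp hb)
  refine ⟨fun i => r ^ D ^ (i : ℕ), fun i => pow_ne_zero _ hr0, ?_⟩
  have key := MvPolynomial.polynomial_eval_eval₂ (x := r) Polynomial.C
    (fun i : Fin N => (Polynomial.X : Polynomial k) ^ D ^ (i : ℕ)) h
  rw [← hq, hr] at key
  have hcomp : (Polynomial.evalRingHom r).comp Polynomial.C = RingHom.id k := by ext c; simp
  rw [hcomp] at key
  simp only [Polynomial.eval_pow, Polynomial.eval_X] at key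
  exact key.symm


end Summit.ResolutionOfSingularities.ResolutionOfSingularities.Cruxes.EquisingularLiftNat.Sections.ND

end
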